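import Literature.Analysis.FluidPDE.FiniteFourierModeEulerPlanarPolyB
import Literature.Analysis.FluidPDE.FiniteFourierModeEulerPlanarVert

/-!
# Kishimoto–Yoneda §3 (planar case), Lemma 3.2: the top layer of a transported support

Support file for `FiniteFourierModeEuler` (N. Kishimoto, T. Yoneda, J. Math. Fluid Mech. 24
(2022) 74 = arXiv:2110.08039), §3 Lemma 3.2 (the combinatorial mechanism, time-free form). Let
`ψ` be a finitely supported function on the plane whose support has maximal gauge `q* > 0`, and
suppose the transport `A ψ` vanishes at all frequencies of gauge `q* + 1` (for a solution of
(cond:Euler^h) these frequencies are unoccupied). Pick `ñ = s V_j + t V_{j+1}` (`s > 0, t ≥ 0`,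
`s + t = q*`) in the top layer. "The interaction between `n_{j+1}` and `ñ` gives non-zero
contribution at `n_{j+1} + ñ` … the only possible [other pair] is `(n_j, ñ + (n_{j+1} - n_j))`":
this yields the RECURSION `(t+1) α_j ψ(ñ + d_j) = s α_{j+1} ψ(ñ)` (`step`), hence
`ψ(ñ + d_j) ≠ 0` and `s ≥ 1`; iterating, `s ∈ ℕ`, `q* ∈ ℕ` (`exists_nat`), the whole lattice
`{(q-k)V_j + kV_{j+1}}` lies in the support (`lat_ne_zero`) with the recursion along it
(`lat_rec`), and the top layer consists of lattice points only (`top_subset_lat`).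

## References

* [KishimotoYoneda2022] N. Kishimoto, T. Yoneda, J. Math. Fluid Mech. 24 (2022) 74 =
  arXiv:2110.08039, §3 Lemma 3.2 and its proof; first display of the proof of Lemma 3.3.
-/

noncomputable section

open Matrix Finset Complex

namespace Literature.Analysis.FluidPDE

namespace KY

open scoped Classical

namespace PolyCfg

variable {T : Finset (Fin 3 → ℝ)} {e : Fin 3 → ℝ}

/-- The data of Lemma 3.2: non-vanishing horizontal coefficients `α` on the vertex set `T` (all of
whose points are vertices: `f_j = 1` only at `V_j, V_{j+1}`), a function `ψ` supported in gauge
`≤ q*` (`q* > 0`), and the vanishing of `A ψ` in gauge `q* + 1`.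
[cite: KishimotoYoneda2022, §3 Lemma 3.2 (hypotheses, with `q := max N` and "`n_{j+1} + ñ ∉ S_⊥`")] -/
structure MechCfg (P : PolyCfg T e) (α ψ : (Fin 3 → ℝ) → ℂ) (qs : ℝ) : Prop where
  hα : ∀ n ∈ T, α n ≠ 0
  hside : ∀ j, ∀ n ∈ T, P.fE j n = 1 → n = P.V j ∨ n = P.V (j + 1)
  hq : 0 < qs
  htop : ∀ n, ψ n ≠ 0 → P.Nf n ≤ qs
  hH : ∀ n, P.Nf n = qs + 1 → convOp T e α ψ n = 0

namespace MechCfg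

variable {P : PolyCfg T e} {α ψ : (Fin 3 → ℝ) → ℂ} {qs : ℝ} (M : MechCfg P α ψ qs)
include M

/-- **One step of Lemma 3.2 (the recursion).** For a top-layer point `ñ = s V_j + t V_{j+1}`
(`s > 0`, `t ≥ 0`, `s + t = q*`) with `ψ(ñ) ≠ 0`:
`(t+1) α_j ψ(ñ + d_j) = s α_{j+1} ψ(ñ)`. [cite: KishimotoYoneda2022, §3 proof of Lemma 3.2; Lemma 3.3 first display] -/
theorem step {j : ℕ} {s t : ℝ} (hs : 0 < s) (ht : 0 ≤ t) (hst : s + t = qs) :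
    ((t + 1 : ℝ) : ℂ) * α (P.V j) * ψ ((s - 1) • P.V j + (t + 1) • P.V (j + 1))
      = ((s : ℝ) : ℂ) * α (P.V (j + 1)) * ψ (s • P.V j + t • P.V (j + 1)) := by
  set x := s • P.V j + t • P.V (j + 1) with hx
  set x' := (s - 1) • P.V j + (t + 1) • P.V (j + 1) with hx'
  set nstar := P.V (j + 1) + x with hn
  -- the gauge of `n* = V_{j+1} + ñ` is `q* + 1`
  have hN : P.Nf nstar = qs + 1 := by
    rw [hn, hx, show P.V (j + 1) + (s • P.V j + t • P.V (j + 1)) = s • P.V j + (t + 1) • P.V (j + 1) by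
      rw [add_smul, one_smul]; abel, P.Nf_sector j hs.le (by linarith)]
    linarith
  have hA := M.hH nstar hN
  unfold convOp at hA
  rw [mul_eq_zero] at hA
  replace hA := hA.resolve_left Complex.I_ne_zero
  -- only `m = V_j` and `m = V_{j+1}` contribute
  have hzero : ∀ m ∈ T, m ≠ P.V j → m ≠ P.V (j + 1) →
      ((pc e m (nstar - m) : ℝ) : ℂ) * α m * ψ (nstar - m) = 0 := by
    intro m hm h1 h2
    by_cases hψ : ψ (nstar - m) = 0
    · rw [hψ, mul_zero]
    · exfalso
      have hle := M.htop _ hψ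
      have hf : P.fE j (nstar - m) ≤ qs := (P.fE_le_Nf j _).trans hle
      rw [P.fE_sub, hn, P.fE_add, hx, P.fE_sector_self, P.fE_V_succ] at hf
      have hfm : P.fE j m = 1 := le_antisymm (P.fE_le_one j hm) (by linarith)
      rcases M.hside j m hm hfm with h | h
      · exact h1 h
      · exact h2 h
  have hne : P.V j ≠ P.V (j + 1) := P.V_ne_succ j
  rw [← Finset.sum_sdiff (Finset.insert_subset_iff.2 ⟨P.V_mem j, Finset.singleton_subset_iff.2 (P.V_mem (j + 1))⟩),
    Finset.sum_eq_zero (fun m hm => by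
      simp only [Finset.mem_sdiff, Finset.mem_insert, Finset.mem_singleton, not_or] at hm
      exact hzero m hm.1 hm.2.1 hm.2.2), zero_add,
    Finset.sum_insert (by simp [hne]), Finset.sum_singleton] at hA
  -- evaluate the two terms
  have e1 : nstar - P.V j = x' := by rw [hn, hx, hx']; simp only [sub_smul, one_smul, add_smul]; abel
  have e2 : nstar - P.V (j + 1) = x := by rw [hn]; abel
  have p1 : pc e (P.V j) x' = (t + 1) * pc e (P.V j) (P.V (j + 1)) := by
    rw [hx', pc_add_right, pc_smul_right, pc_smul_right, pc_self, mul_zero, zero_add]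
  have p2 : pc e (P.V (j + 1)) x = -(s * pc e (P.V j) (P.V (j + 1))) := by
    rw [hx, pc_add_right, pc_smul_right, pc_smul_right, pc_self, mul_zero, add_zero, pc_anticomm]; ring
  rw [e1, e2, p1, p2] at hA
  have hτ : ((pc e (P.V j) (P.V (j + 1)) : ℝ) : ℂ) ≠ 0 := by exact_mod_cast (P.tau_pos j).ne'
  push_cast at hA
  have : ((pc e (P.V j) (P.V (j + 1)) : ℝ) : ℂ) *
      (((t + 1 : ℝ) : ℂ) * α (P.V j) * ψ x' - ((s : ℝ) : ℂ) * α (P.V (j + 1)) * ψ x) = 0 := by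
    push_cast; linear_combination hA
  exact sub_eq_zero.1 ((mul_eq_zero.1 this).resolve_left hτ)

/-- The shifted point is again in the support. [cite: KishimotoYoneda2022, §3 proof of Lemma 3.2 ("the point `ñ + (n_{j+1} - n_j)` must be in `S_⊥(t₀)`")] -/
theorem shift_ne_zero {j : ℕ} {s t : ℝ} (hs : 0 < s) (ht : 0 ≤ t) (hst : s + t = qs)
    (hψ : ψ (s • P.V j + t • P.V (j + 1)) ≠ 0) :
    ψ ((s - 1) • P.V j + (t + 1) • P.V (j + 1)) ≠ 0 := by
  intro h0
  have h := M.step (j := j) hs ht hst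
  rw [h0, mul_zero] at h
  have hs' : ((s : ℝ) : ℂ) ≠ 0 := by exact_mod_cast hs.ne'
  exact (mul_ne_zero (mul_ne_zero hs' (M.hα _ (P.V_mem (j + 1)))) hψ) h.symm

/-- … hence `s ≥ 1`. [cite: KishimotoYoneda2022, §3 proof of Lemma 3.2 ("otherwise … a point in `S_⊥(t₀)` outside the polygon `qS^{conv}_∥`")] -/
theorem one_le {j : ℕ} {s t : ℝ} (hs : 0 < s) (ht : 0 ≤ t) (hst : s + t = qs)
    (hψ : ψ (s • P.V j + t • P.V (j + 1)) ≠ 0) : 1 ≤ s := by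
  by_contra hlt
  rw [not_le] at hlt
  have hne := M.shift_ne_zero hs ht hst hψ
  have hle := M.htop _ hne
  -- the gauge of the shifted point exceeds `q*`
  have hg : P.fE (j + 1) (P.V j) < 1 := P.fE_lt_one_of_V (P.V_ne_succ j) (P.V_ne_add_two j)
  have hgt : s + t < P.fE (j + 1) ((s - 1) • P.V j + (t + 1) • P.V (j + 1)) := by
    rw [show (s - 1) • P.V j + (t + 1) • P.V (j + 1)
        = s • P.V j + t • P.V (j + 1) + (P.V (j + 1) - P.V j) by simp only [sub_smul, add_smul, one_smul]; abel,
      P.fE_add, P.fE_combo, P.fE_sub, P.fE_V_self]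
    nlinarith [mul_pos (sub_pos.2 hg) (sub_pos.2 hlt)]
  have := (P.fE_le_Nf (j + 1) _).trans hle
  linarith

/-- **Integrality of the `V_j`-coefficient.** [cite: KishimotoYoneda2022, §3 proof of Lemma 3.2 ("`ñ + r(n_{j+1} - n_j) = q n_{j+1}` for some positive integer `r`")] -/
theorem exists_nat_coeff (k : ℕ) : ∀ {j : ℕ} {s t : ℝ}, 0 < s → 0 ≤ t → s + t = qs → s ≤ k →
    ψ (s • P.V j + t • P.V (j + 1)) ≠ 0 → ∃ r : ℕ, (r : ℝ) = s := by
  induction k with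
  | zero => intro j s t hs ht hst hk hψ; exfalso; simp at hk; linarith
  | succ k ih =>
    intro j s t hs ht hst hk hψ
    have h1 := M.one_le hs ht hst hψ
    rcases h1.lt_or_eq with hlt | heq
    · -- step once
      have hne := M.shift_ne_zero hs ht hst hψ
      obtain ⟨r, hr⟩ := ih (by linarith) (by linarith) (by linarith) (by push_cast at hk; linarith) hne
      exact ⟨r + 1, by push_cast; linarith⟩
    · exact ⟨1, by exact_mod_cast heq⟩

/-- Iterating the step down to the vertex: `ψ(q* V_{j+1}) ≠ 0`. [cite: KishimotoYoneda2022, §3 proof of Lemma 3.2 ("we have `q n_{j+1} ∈ S_⊥(t₀)`")] -/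
theorem vertex_ne_zero_of_top (r : ℕ) : ∀ {j : ℕ} {s t : ℝ}, (r : ℝ) = s → 0 < s → 0 ≤ t → s + t = qs →
    ψ (s • P.V j + t • P.V (j + 1)) ≠ 0 → ψ (qs • P.V (j + 1)) ≠ 0 := by
  induction r with
  | zero => intro j s t hr hs; simp at hr; intros; linarith
  | succ r ih =>
    intro j s t hr hs ht hst hψ
    have hne := M.shift_ne_zero hs ht hst hψ
    rcases Nat.eq_zero_or_pos r with h0 | hpos
    · subst h0
      have hs1 : s = 1 := by push_cast at hr; linarith
      rwa [hs1, sub_self, zero_smul, zero_add, show t + 1 = qs by linarith] at hne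
    · push_cast at hr
      exact ih (by linarith) (by
        have : (1 : ℝ) ≤ r := by exact_mod_cast hpos
        linarith) (by linarith) (by linarith) hne

/-- **`q*` is a positive integer** (given that the top layer is attained). [cite: KishimotoYoneda2022, §3 Lemma 3.2 ("`q` must be an integer")] -/
theorem exists_nat (hattained : ∃ n, ψ n ≠ 0 ∧ P.Nf n = qs) (hplane : ∀ n, ψ n ≠ 0 → e ⬝ᵥ n = 0) :
    ∃ q : ℕ, 0 < q ∧ (q : ℝ) = qs ∧ ∃ j, ψ ((q : ℝ) • P.V j) ≠ 0 := by
  obtain ⟨n, hn, hN⟩ := hattained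
  have hn0 : n ≠ 0 := by
    intro h; rw [h] at hN
    have : P.Nf 0 = 0 := by
      have := P.Nf_sector 0 le_rfl le_rfl (s := 0) (t := 0)
      simpa using this
    linarith [M.hq]
  obtain ⟨j, -, s, t, hs, ht, hne⟩ := P.exists_sector (hplane n hn) hn0
  have hst : s + t = qs := by rw [← hN, hne, P.Nf_sector j hs.le ht]
  rw [hne] at hn
  obtain ⟨r, hr⟩ := M.exists_nat_coeff (Nat.ceil s) hs ht hst (Nat.le_ceil s) hn
  have hv := M.vertex_ne_zero_of_top r hr hs ht hst hn
  -- now `q* V_{j+1}` is a top point of sector `j+1` with coefficient `q*`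
  obtain ⟨q, hq⟩ := M.exists_nat_coeff (Nat.ceil qs) (j := j + 1) (s := qs) (t := 0) M.hq le_rfl
    (by ring) (Nat.le_ceil qs) (by rw [zero_smul, add_zero]; exact hv)
  refine ⟨q, ?_, hq, j + 1, by rw [hq]; exact hv⟩
  have : (0 : ℝ) < q := by rw [hq]; exact M.hq
  exact_mod_cast this

end MechCfg

/-! ### The lattice of the top layer (for integer `q`) -/

/-- The lattice point `ñ_{j,k} = (q-k) V_j + k V_{j+1}`. [cite: KishimotoYoneda2022, §3 Lemma 3.2 (`ñ_{j,k}`)] -/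
def lat (P : PolyCfg T e) (q : ℕ) (j k : ℕ) : Fin 3 → ℝ := ((q : ℝ) - k) • P.V j + (k : ℝ) • P.V (j + 1)

namespace MechCfg

variable {P : PolyCfg T e} {α ψ : (Fin 3 → ℝ) → ℂ} {q : ℕ} (M : MechCfg P α ψ q)
include M

omit M in
/-- Bookkeeping for the transport operator / `Ω_q`: `lat_zero`. [folklore] -/
theorem lat_zero (j : ℕ) : P.lat q j 0 = (q : ℝ) • P.V j := by unfold lat; simp

omit M in
/-- Bookkeeping for the transport operator / `Ω_q`: `lat_self`. [folklore] -/
theorem lat_self (j : ℕ) : P.lat q j q = (q : ℝ) • P.V (j + 1) := by unfold lat; simp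

omit M in
/-- Bookkeeping for the transport operator / `Ω_q`: `lat_succ`. [folklore] -/
theorem lat_succ (j k : ℕ) :
    P.lat q j (k + 1) = ((q : ℝ) - k - 1) • P.V j + ((k : ℝ) + 1) • P.V (j + 1) := by
  unfold lat; rw [Nat.cast_succ, sub_add_eq_sub_sub]

/-- **The recursion along the lattice**: `(k+1) α_j ψ(ñ_{j,k+1}) = (q-k) α_{j+1} ψ(ñ_{j,k})` for
`k < q`. [cite: KishimotoYoneda2022, §3 proof of Lemma 3.3 (first two displays)] -/
theorem lat_rec {j k : ℕ} (hk : k < q) :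
    (((k : ℝ) + 1 : ℝ) : ℂ) * α (P.V j) * ψ (P.lat q j (k + 1))
      = (((q : ℝ) - k : ℝ) : ℂ) * α (P.V (j + 1)) * ψ (P.lat q j k) := by
  have hk' : (k : ℝ) < q := by exact_mod_cast hk
  rw [lat_succ]
  exact M.step (j := j) (s := (q : ℝ) - k) (t := k) (by linarith) (Nat.cast_nonneg k) (by ring)

/-- One lattice step inside a sector. [cite: KishimotoYoneda2022, §3 proof of Lemma 3.2] -/
theorem lat_step_ne_zero {j k : ℕ} (hk : k < q) (h : ψ (P.lat q j k) ≠ 0) : ψ (P.lat q j (k + 1)) ≠ 0 := by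
  have hk' : (k : ℝ) < q := by exact_mod_cast hk
  rw [lat_succ]
  exact M.shift_ne_zero (j := j) (s := (q : ℝ) - k) (t := k) (by linarith) (Nat.cast_nonneg k) (by ring) h

/-- A whole sector from its first vertex. [cite: KishimotoYoneda2022, §3 proof of Lemma 3.2] -/
theorem lat_sector_ne_zero {j : ℕ} (h : ψ ((q : ℝ) • P.V j) ≠ 0) : ∀ k, k ≤ q → ψ (P.lat q j k) ≠ 0 := by
  intro k hk
  induction k with
  | zero => rw [lat_zero]; exact h
  | succ k ih => exact M.lat_step_ne_zero hk (ih (Nat.le_of_succ_le hk))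

/-- **All lattice points lie in the support.** [cite: KishimotoYoneda2022, §3 Lemma 3.2 ("`{ñ ∈ S_⊥ : N(ñ) = q} = {ñ_{j,k}}`", the inclusion `⊇`)] -/
theorem lat_ne_zero {j₀ : ℕ} (h₀ : ψ ((q : ℝ) • P.V j₀) ≠ 0) : ∀ j k, k ≤ q → ψ (P.lat q j k) ≠ 0 := by
  -- forward propagation of the vertex values from `j₀`
  have hfwd : ∀ i, ψ ((q : ℝ) • P.V (j₀ + i)) ≠ 0 := by
    intro i
    induction i with
    | zero => simpa using h₀
    | succ i ih =>
      have := M.lat_sector_ne_zero ih q le_rfl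
      rwa [lat_self, show j₀ + i + 1 = j₀ + (i + 1) by ring] at this
  intro j k hk
  -- `V j = V (j₀ + i)` for a suitable `i`, by periodicity
  have hper : ∀ L i, P.V (i + L * (P.m + 1)) = P.V i := by
    intro L
    induction L with
    | zero => simp
    | succ L ih => intro i; rw [Nat.succ_mul, ← add_assoc, P.V_periodic, ih]
  have hidx : j₀ + (j + j₀ * (P.m + 1) - j₀) = j + j₀ * (P.m + 1) := by
    have : j₀ ≤ j + j₀ * (P.m + 1) := le_add_left (Nat.le_mul_of_pos_right j₀ (Nat.succ_pos _))
    omega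
  have hv : ψ ((q : ℝ) • P.V j) ≠ 0 := by
    have := hfwd (j + j₀ * (P.m + 1) - j₀)
    rwa [hidx, hper] at this
  exact M.lat_sector_ne_zero hv k hk

/-- **The top layer consists of lattice points only.** [cite: KishimotoYoneda2022, §3 Lemma 3.2 (the inclusion `⊆`)] -/
theorem top_subset_lat (hplane : ∀ n, ψ n ≠ 0 → e ⬝ᵥ n = 0) {n : Fin 3 → ℝ} (hn : ψ n ≠ 0)
    (hN : P.Nf n = q) : ∃ j k, k ≤ q ∧ n = P.lat q j k := by
  have hq : (0 : ℝ) < q := M.hq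
  have hn0 : n ≠ 0 := by
    intro h; rw [h] at hN
    have : P.Nf 0 = 0 := by
      have := P.Nf_sector 0 le_rfl le_rfl (s := 0) (t := 0)
      simpa using this
    linarith
  obtain ⟨j, -, s, t, hs, ht, hne⟩ := P.exists_sector (hplane n hn) hn0
  have hst : s + t = q := by rw [← hN, hne, P.Nf_sector j hs.le ht]
  rw [hne] at hn
  obtain ⟨r, hr⟩ := M.exists_nat_coeff (Nat.ceil s) hs ht hst (Nat.le_ceil s) hn
  have hrq : r ≤ q := by
    have : (r : ℝ) ≤ q := by rw [hr]; linarith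
    exact_mod_cast this
  refine ⟨j, q - r, Nat.sub_le _ _, ?_⟩
  have e1 : ((q : ℝ) - ((q : ℝ) - (r : ℝ))) = s := by rw [← hr]; ring
  have e2 : ((q : ℝ) - (r : ℝ)) = t := by rw [hr]; linarith
  rw [hne]; unfold lat; rw [Nat.cast_sub hrq, e1, e2]

end MechCfg

end PolyCfg

end KY

end Literature.Analysis.FluidPDE
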